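import Summits.Parity.BatemanHorn.Theorems.SoloInformedTwinBalancedSplit

/-!
# SoloInformedTwinUnbalancedSwitch — the unbalanced part of the located twin sum after divisor
# switching: four bilinear class sums

Solo unit `solo-Parity-informed` (ideation tier, informed mode), session 79; `paper.md` §20
(Theorem 20.1 = (F′), steps (0)–(1)), PLAN §60 (file F1 of the kernel project F1–F5, first half;
second half = `SoloInformedTwinUnbalancedPieces`), CLAIMS C144/C147.

`SoloInformedTwinBalancedSplit` (C120) splits the located twin sum `T(x; y)` of C89/C118 as
`T = U + W + R`, `U = twinUnbalancedSum x y z` = the pairs `(e₁ ∣ n, e₂ ∣ n+2)` with `min(e₁,e₂) ≤ z`.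
The prose theorem (F′) — `U = o(x)` for `y = x^{1-ε}`, `z = x^{1/2-ε₀}` — begins with two purely
ARITHMETIC steps, recorded here exactly and for all parameters (no estimate is proved):

1. `U = U₁ + U₂ − U₁₂` (`e₁ ≤ z` / `e₂ ≤ z` / both), and `U₁₂ = 0` as soon as `z² ≤ y`
   (`twinUnbalancedSum_eq_fst_add_snd_sub_both`, `twinUnbalancedBoth_eq_zero_of_sq_le`);
2. DIVISOR SWITCHING.  In `U₁` the small divisor `q = e₁ ≤ z` is kept as a modulus and the
   complementary divisor of the LARGE one is introduced: odd `n`, `n + 2 = k·e₂`, so that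
   `#{n ≤ x odd : q ∣ n, e₂ ∣ n+2}` becomes the condition `k e₂ ≡ 2 (mod q)`, `k e₂` odd,
   `3 ≤ k e₂ ≤ x+2`; even `n = 2m`, `m + 1 = k·e₂`: `k e₂ ≡ 1 (mod q)`, `2 ≤ k e₂ ≤ x/2+1`.  In `U₂`
   (`q = e₂ ≤ z`) one switches `n = k·e₁` resp. `m = k·e₁`: classes `k e₁ ≡ −2` resp. `−1 (mod q)`.
   All four are ONE generic object `switchedSum lo hi q r₀ a w`
   (`= ∑_{k,e} 𝟙[lo ≤ ke ≤ hi, (ke,r₀)=1, ke ≡ a (q)] w(e)`, `r₀ = 2` encoding "odd", the congruence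
   typed as in `Literature.NumberTheory.Sieve.BFI.bilinDisc`), and `twinUnbalancedSum_eq_switched`
   is the exact identity (for `z² ≤ y`)
   `U = ∑_{q ≤ z} [S(3,x+2;q,2,2) + S(2,x/2+1;q,1,1) + S(1,x;q,2,−2) + S(1,x/2;q,1,−1)](w_q)`,
   `w_q(e) = 𝟙[y < qe] μ(q)μ(e) log²(qe)`.

The companion file expands `log²(qe)` and identifies the `e`-variable with the Möbius log-power
pieces of `SoloInformedMoebiusSWHypAux` (F2).  Deliberately NOT here: any estimate ((F′) itself is
files F3–F5).
-/

namespace Summit.Parity.BatemanHorn.Theorems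

open Finset ArithmeticFunction
open scoped ArithmeticFunction.Moebius

/-! ### 1. One-sided unbalanced sums: `U = U₁ + U₂ − U₁₂` -/

/-- `U₁`: the pairs with `e₁ ≤ z`. -/
noncomputable def twinUnbalancedFst (x y z : ℕ) : ℝ :=
  ∑ e₁ ∈ Icc 1 (x + 2), ∑ e₂ ∈ Icc 1 (x + 2), if e₁ ≤ z then twinPairTerm x y e₁ e₂ else 0

/-- `U₂`: the pairs with `e₂ ≤ z`. -/
noncomputable def twinUnbalancedSnd (x y z : ℕ) : ℝ :=
  ∑ e₁ ∈ Icc 1 (x + 2), ∑ e₂ ∈ Icc 1 (x + 2), if e₂ ≤ z then twinPairTerm x y e₁ e₂ else 0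

/-- `U₁₂`: the pairs with `e₁ ≤ z` and `e₂ ≤ z`. -/
noncomputable def twinUnbalancedBoth (x y z : ℕ) : ℝ :=
  ∑ e₁ ∈ Icc 1 (x + 2), ∑ e₂ ∈ Icc 1 (x + 2), if e₁ ≤ z ∧ e₂ ≤ z then twinPairTerm x y e₁ e₂ else 0

/-- Inclusion–exclusion on `𝟙[min(e₁,e₂) ≤ z]`. -/
theorem ite_min_le_eq (t : ℝ) (z e₁ e₂ : ℕ) :
    (if min e₁ e₂ ≤ z then t else 0)
      = (if e₁ ≤ z then t else 0) + (if e₂ ≤ z then t else 0)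
          - (if e₁ ≤ z ∧ e₂ ≤ z then t else 0) := by
  by_cases h1 : e₁ ≤ z <;> by_cases h2 : e₂ ≤ z <;> simp [h1, h2]

/-- **`U = U₁ + U₂ − U₁₂`** (every `x, y, z`). -/
theorem twinUnbalancedSum_eq_fst_add_snd_sub_both (x y z : ℕ) :
    twinUnbalancedSum x y z
      = twinUnbalancedFst x y z + twinUnbalancedSnd x y z - twinUnbalancedBoth x y z := by
  rw [twinUnbalancedSum, twinUnbalancedFst, twinUnbalancedSnd, twinUnbalancedBoth,
    ← sum_add_distrib, ← sum_sub_distrib]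
  refine sum_congr rfl fun e₁ _ => ?_
  rw [← sum_add_distrib, ← sum_sub_distrib]
  refine sum_congr rfl fun e₂ _ => ?_
  exact ite_min_le_eq _ z e₁ e₂

/-- For `z² ≤ y` the doubly unbalanced pairs contribute nothing (`e₁e₂ ≤ z² ≤ y` kills `𝟙[y < e₁e₂]`). -/
theorem twinUnbalancedBoth_eq_zero_of_sq_le {y z : ℕ} (h : z * z ≤ y) (x : ℕ) :
    twinUnbalancedBoth x y z = 0 := by
  refine sum_eq_zero fun e₁ _ => sum_eq_zero fun e₂ _ => ?_
  split_ifs with hz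
  · have hle : e₁ * e₂ ≤ y := (Nat.mul_le_mul hz.1 hz.2).trans h
    rw [twinPairTerm, if_neg (not_lt.mpr hle), zero_mul]
  · rfl

/-- **`U = U₁ + U₂`** when `z² ≤ y`. -/
theorem twinUnbalancedSum_eq_fst_add_snd {y z : ℕ} (h : z * z ≤ y) (x : ℕ) :
    twinUnbalancedSum x y z = twinUnbalancedFst x y z + twinUnbalancedSnd x y z := by
  rw [twinUnbalancedSum_eq_fst_add_snd_sub_both, twinUnbalancedBoth_eq_zero_of_sq_le h, sub_zero]

/-! ### 2. The pair weight and the generic switched sum -/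

/-- The weight of a pair: `w_y(q, e) = 𝟙[y < qe] μ(q) μ(e) log²(qe)`. -/
noncomputable def twinSwitchWeight (y q e : ℕ) : ℝ :=
  if y < q * e then (μ q : ℝ) * μ e * Real.log (q * e : ℕ) ^ 2 else 0

/-- `twinPairTerm = weight × pair count` (definitional). -/
theorem twinPairTerm_eq_weight_mul (x y e₁ e₂ : ℕ) :
    twinPairTerm x y e₁ e₂ = twinSwitchWeight y e₁ e₂ * twinPairCount x e₁ e₂ := rfl

/-- The weight is symmetric. -/
theorem twinSwitchWeight_comm (y q e : ℕ) : twinSwitchWeight y q e = twinSwitchWeight y e q := by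
  unfold twinSwitchWeight
  rw [Nat.mul_comm q e]
  split_ifs <;> ring

/-- **The generic switched sum** with cofactor `k`, switched divisor `e`, modulus `q`, residue `a`
and coprimality parameter `r₀` (`r₀ = 2`: `ke` odd; `r₀ = 1`: no condition):
`S(lo, hi; q, r₀, a)(w) = ∑_{k, e ≤ hi} 𝟙[lo ≤ ke ≤ hi] 𝟙[(ke, r₀) = 1] 𝟙[ke ≡ a (mod q)] w(e)`.
The congruence is typed as in `Literature.NumberTheory.Sieve.BFI.bilinDisc` (`(ke : ZMod q) = a`). -/
noncomputable def switchedSum (lo hi q r₀ : ℕ) (a : ℤ) (w : ℕ → ℝ) : ℝ :=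
  ∑ k ∈ Icc 1 hi, ∑ e ∈ Icc 1 hi,
    if lo ≤ k * e ∧ k * e ≤ hi ∧ (k * e).Coprime r₀ ∧ ((k * e : ℕ) : ZMod q) = (a : ZMod q)
    then w e else 0

/-- The typed congruence unfolded: `(t : ZMod q) = a ⟺ q ∣ a − t` in `ℤ` (all `q`, incl. `q = 0`). -/
theorem natCast_zmod_eq_intCast_iff (t q : ℕ) (a : ℤ) :
    ((t : ℕ) : ZMod q) = (a : ZMod q) ↔ (q : ℤ) ∣ a - t := by
  rw [← Int.cast_natCast (R := ZMod q) t]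
  exact ZMod.intCast_eq_intCast_iff_dvd_sub _ _ _

/-- Divisor switching at the level of counts: for `e ≥ 1`, `lo ≥ 1`, the multiples of `e` in
`[lo, hi]` satisfying the (coprimality, class) condition are in bijection with the cofactors `k`. -/
theorem card_filter_dvd_eq_card_cofactor {e lo : ℕ} (he : 0 < e) (hlo : 1 ≤ lo) (hi q r₀ : ℕ)
    (a : ℤ) :
    #{t ∈ Icc lo hi | e ∣ t ∧ t.Coprime r₀ ∧ ((t : ℕ) : ZMod q) = (a : ZMod q)}
      = #{k ∈ Icc 1 hi | lo ≤ k * e ∧ k * e ≤ hi ∧ (k * e).Coprime r₀ ∧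
          ((k * e : ℕ) : ZMod q) = (a : ZMod q)} := by
  refine card_nbij' (fun t => t / e) (fun k => k * e) (fun t ht => ?_) (fun k hk => ?_)
    (fun t ht => ?_) (fun k hk => ?_)
  · simp only [mem_coe, mem_filter, mem_Icc] at ht ⊢
    obtain ⟨⟨hlo', hhi⟩, hdvd, hP⟩ := ht
    have ht0 : 0 < t := by omega
    have hte : t / e * e = t := Nat.div_mul_cancel hdvd
    refine ⟨⟨Nat.div_pos (Nat.le_of_dvd ht0 hdvd) he, (Nat.div_le_self t e).trans hhi⟩, ?_, ?_, ?_⟩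
    · rw [hte]; exact hlo'
    · rw [hte]; exact hhi
    · rw [hte]; exact hP
  · simp only [mem_coe, mem_filter, mem_Icc] at hk ⊢
    obtain ⟨_, hlo', hhi, hP⟩ := hk
    exact ⟨⟨hlo', hhi⟩, dvd_mul_left e k, hP⟩
  · simp only [mem_coe, mem_filter] at ht
    exact Nat.div_mul_cancel ht.2.1
  · exact Nat.mul_div_cancel k he

/-- **Divisor switching.**  For `lo ≥ 1` and `hi ≤ B`:
`∑_{e ≤ B} w(e) · #{t ∈ [lo, hi] : e ∣ t, (t, r₀) = 1, t ≡ a (q)} = S(lo, hi; q, r₀, a)(w)`. -/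
theorem sum_mul_card_eq_switchedSum {lo hi B : ℕ} (hlo : 1 ≤ lo) (hB : hi ≤ B) (q r₀ : ℕ) (a : ℤ)
    (w : ℕ → ℝ) :
    ∑ e ∈ Icc 1 B, w e * #{t ∈ Icc lo hi | e ∣ t ∧ t.Coprime r₀ ∧ ((t : ℕ) : ZMod q) = (a : ZMod q)}
      = switchedSum lo hi q r₀ a w := by
  have h1 : ∀ e ∈ Icc 1 B,
      w e * #{t ∈ Icc lo hi | e ∣ t ∧ t.Coprime r₀ ∧ ((t : ℕ) : ZMod q) = (a : ZMod q)}
        = ∑ k ∈ Icc 1 hi, if lo ≤ k * e ∧ k * e ≤ hi ∧ (k * e).Coprime r₀ ∧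
            ((k * e : ℕ) : ZMod q) = (a : ZMod q) then w e else 0 := by
    intro e he
    rw [card_filter_dvd_eq_card_cofactor (mem_Icc.mp he).1 hlo hi q r₀ a, sum_ite, sum_const_zero,
      add_zero, sum_const, nsmul_eq_mul, mul_comm]
  rw [sum_congr rfl h1, switchedSum, sum_comm]
  refine sum_congr rfl fun k hk => ?_
  symm
  refine sum_subset (Icc_subset_Icc_right hB) fun e heB he => ?_
  rw [if_neg]
  rintro ⟨_, hhi, _⟩
  have hk1 := (mem_Icc.mp hk).1
  have he1 := (mem_Icc.mp heB).1
  have : e ≤ hi := le_trans (Nat.le_mul_of_pos_left e hk1) hhi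
  exact he (mem_Icc.mpr ⟨he1, this⟩)

/-! ### 3. The four counts as conditions on the switched variable -/

/-- Odd family, switching `n + 2 = t`: `#{n ≤ x odd : q ∣ n, e ∣ n+2}
  = #{t ∈ [3, x+2] : e ∣ t, t odd, t ≡ 2 (q)}`. -/
theorem card_odd_dvd_dvd_add_two_eq (x q e : ℕ) :
    #{n ∈ (Icc 1 x).filter Odd | q ∣ n ∧ e ∣ n + 2}
      = #{t ∈ Icc 3 (x + 2) | e ∣ t ∧ t.Coprime 2 ∧ ((t : ℕ) : ZMod q) = ((2 : ℤ) : ZMod q)} := by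
  refine card_nbij' (fun n => n + 2) (fun t => t - 2) (fun n hn => ?_) (fun t ht => ?_)
    (fun n _ => by simp) (fun t ht => ?_)
  · simp only [mem_coe, mem_filter, mem_Icc] at hn ⊢
    obtain ⟨⟨⟨h1, hx⟩, hodd⟩, hq, he⟩ := hn
    refine ⟨⟨by omega, by omega⟩, he, Nat.coprime_two_right.mpr (hodd.add_even even_two), ?_⟩
    rw [natCast_zmod_eq_intCast_iff]
    push_cast
    rw [show (2 : ℤ) - (n + 2) = -(n : ℤ) by ring, dvd_neg, Int.natCast_dvd_natCast]
    exact hq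
  · simp only [mem_coe, mem_filter, mem_Icc] at ht ⊢
    obtain ⟨⟨h3, hx⟩, he, hcop, hcl⟩ := ht
    rw [natCast_zmod_eq_intCast_iff] at hcl
    refine ⟨⟨⟨by omega, by omega⟩, ?_⟩, ?_, ?_⟩
    · exact Nat.Odd.sub_even (by omega) (Nat.coprime_two_right.mp hcop) even_two
    · have h' : (q : ℤ) ∣ ((t - 2 : ℕ) : ℤ) := by
        rw [Nat.cast_sub (by omega : 2 ≤ t)]
        push_cast
        rw [show (t : ℤ) - 2 = -((2 : ℤ) - t) by ring, dvd_neg]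
        exact hcl
      exact Int.natCast_dvd_natCast.mp h'
    · rwa [show t - 2 + 2 = t by omega]
  · simp only [mem_coe, mem_filter, mem_Icc] at ht
    show t - 2 + 2 = t
    omega

/-- Even family, switching `m + 1 = t`: `#{m ≤ X : q ∣ m, e ∣ m+1}
  = #{t ∈ [2, X+1] : e ∣ t, t ≡ 1 (q)}` (`r₀ = 1`: no parity condition). -/
theorem card_dvd_dvd_add_one_eq (X q e : ℕ) :
    #{m ∈ Icc 1 X | q ∣ m ∧ e ∣ m + 1}
      = #{t ∈ Icc 2 (X + 1) | e ∣ t ∧ t.Coprime 1 ∧ ((t : ℕ) : ZMod q) = ((1 : ℤ) : ZMod q)} := by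
  refine card_nbij' (fun m => m + 1) (fun t => t - 1) (fun m hm => ?_) (fun t ht => ?_)
    (fun m _ => by simp) (fun t ht => ?_)
  · simp only [mem_coe, mem_filter, mem_Icc] at hm ⊢
    obtain ⟨⟨h1, hX⟩, hq, he⟩ := hm
    refine ⟨⟨by omega, by omega⟩, he, Nat.coprime_one_right _, ?_⟩
    rw [natCast_zmod_eq_intCast_iff]
    push_cast
    rw [show (1 : ℤ) - (m + 1) = -(m : ℤ) by ring, dvd_neg, Int.natCast_dvd_natCast]
    exact hq
  · simp only [mem_coe, mem_filter, mem_Icc] at ht ⊢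
    obtain ⟨⟨h2, hX⟩, he, -, hcl⟩ := ht
    rw [natCast_zmod_eq_intCast_iff] at hcl
    refine ⟨⟨by omega, by omega⟩, ?_, ?_⟩
    · have h' : (q : ℤ) ∣ ((t - 1 : ℕ) : ℤ) := by
        rw [Nat.cast_sub (by omega : 1 ≤ t)]
        push_cast
        rw [show (t : ℤ) - 1 = -((1 : ℤ) - t) by ring, dvd_neg]
        exact hcl
      exact Int.natCast_dvd_natCast.mp h'
    · rwa [show t - 1 + 1 = t by omega]
  · simp only [mem_coe, mem_filter, mem_Icc] at ht
    show t - 1 + 1 = t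
    omega

/-- Odd family, switching `n = t` itself: `#{n ≤ x odd : e ∣ n, q ∣ n+2}
  = #{t ∈ [1, x] : e ∣ t, t odd, t ≡ −2 (q)}`. -/
theorem card_odd_dvd_dvd_add_two_eq' (x q e : ℕ) :
    #{n ∈ (Icc 1 x).filter Odd | e ∣ n ∧ q ∣ n + 2}
      = #{t ∈ Icc 1 x | e ∣ t ∧ t.Coprime 2 ∧ ((t : ℕ) : ZMod q) = ((-2 : ℤ) : ZMod q)} := by
  rw [filter_filter]
  refine congr_arg _ (filter_congr fun n _ => ?_)
  rw [natCast_zmod_eq_intCast_iff, show (-2 : ℤ) - n = -((n + 2 : ℕ) : ℤ) by push_cast; ring,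
    dvd_neg, Int.natCast_dvd_natCast, Nat.coprime_two_right]
  tauto

/-- Even family, switching `m = t` itself: `#{m ≤ X : e ∣ m, q ∣ m+1}
  = #{t ∈ [1, X] : e ∣ t, t ≡ −1 (q)}`. -/
theorem card_dvd_dvd_add_one_eq' (X q e : ℕ) :
    #{m ∈ Icc 1 X | e ∣ m ∧ q ∣ m + 1}
      = #{t ∈ Icc 1 X | e ∣ t ∧ t.Coprime 1 ∧ ((t : ℕ) : ZMod q) = ((-1 : ℤ) : ZMod q)} := by
  refine congr_arg _ (filter_congr fun m _ => ?_)
  rw [natCast_zmod_eq_intCast_iff, show (-1 : ℤ) - m = -((m + 1 : ℕ) : ℤ) by push_cast; ring,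
    dvd_neg, Int.natCast_dvd_natCast]
  simp

/-! ### 4. `U₁`, `U₂` and `U` in switched form -/

/-- The `e₂`-sum of a fixed small divisor `q = e₁`, switched:
`∑_{e₂} twinPairTerm(q, e₂) = S(3, x+2; q, 2, 2)(w_q) + S(2, x/2+1; q, 1, 1)(w_q)`. -/
theorem sum_twinPairTerm_fst_eq_switched (x y q : ℕ) :
    ∑ e₂ ∈ Icc 1 (x + 2), twinPairTerm x y q e₂
      = switchedSum 3 (x + 2) q 2 2 (twinSwitchWeight y q)
        + switchedSum 2 (x / 2 + 1) q 1 1 (twinSwitchWeight y q) := by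
  have hx : x / 2 + 1 ≤ x + 2 := by omega
  rw [← sum_mul_card_eq_switchedSum (by norm_num) le_rfl, ← sum_mul_card_eq_switchedSum (by norm_num) hx,
    ← sum_add_distrib]
  refine sum_congr rfl fun e₂ _ => ?_
  rw [twinPairTerm_eq_weight_mul, twinPairCount, mul_add, card_odd_dvd_dvd_add_two_eq,
    card_dvd_dvd_add_one_eq]

/-- The `e₁`-sum of a fixed small divisor `q = e₂`, switched:
`∑_{e₁} twinPairTerm(e₁, q) = S(1, x; q, 2, −2)(w_q) + S(1, x/2; q, 1, −1)(w_q)`. -/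
theorem sum_twinPairTerm_snd_eq_switched (x y q : ℕ) :
    ∑ e₁ ∈ Icc 1 (x + 2), twinPairTerm x y e₁ q
      = switchedSum 1 x q 2 (-2) (twinSwitchWeight y q)
        + switchedSum 1 (x / 2) q 1 (-1) (twinSwitchWeight y q) := by
  have hx : x ≤ x + 2 := by omega
  have hx' : x / 2 ≤ x + 2 := by omega
  rw [← sum_mul_card_eq_switchedSum le_rfl hx, ← sum_mul_card_eq_switchedSum le_rfl hx',
    ← sum_add_distrib]
  refine sum_congr rfl fun e₁ _ => ?_
  rw [twinPairTerm_eq_weight_mul, twinSwitchWeight_comm, twinPairCount, mul_add,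
    card_odd_dvd_dvd_add_two_eq', card_dvd_dvd_add_one_eq']

/-- **`U₁` switched**: `U₁ = ∑_{q ≤ z} [S(3, x+2; q, 2, 2) + S(2, x/2+1; q, 1, 1)](w_q)`. -/
theorem twinUnbalancedFst_eq_switched (x y z : ℕ) :
    twinUnbalancedFst x y z = ∑ q ∈ Icc 1 (x + 2), if q ≤ z then
        switchedSum 3 (x + 2) q 2 2 (twinSwitchWeight y q)
          + switchedSum 2 (x / 2 + 1) q 1 1 (twinSwitchWeight y q) else 0 := by
  refine sum_congr rfl fun q _ => ?_
  rw [sum_ite_irrel, sum_const_zero, sum_twinPairTerm_fst_eq_switched x y q]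

/-- **`U₂` switched**: `U₂ = ∑_{q ≤ z} [S(1, x; q, 2, −2) + S(1, x/2; q, 1, −1)](w_q)`. -/
theorem twinUnbalancedSnd_eq_switched (x y z : ℕ) :
    twinUnbalancedSnd x y z = ∑ q ∈ Icc 1 (x + 2), if q ≤ z then
        switchedSum 1 x q 2 (-2) (twinSwitchWeight y q)
          + switchedSum 1 (x / 2) q 1 (-1) (twinSwitchWeight y q) else 0 := by
  rw [twinUnbalancedSnd, sum_comm]
  refine sum_congr rfl fun q _ => ?_
  rw [sum_ite_irrel, sum_const_zero, sum_twinPairTerm_snd_eq_switched x y q]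

/-- **The unbalanced part in switched form** (`z² ≤ y`):
`U(x; y, z) = ∑_{q ≤ z} [S(3,x+2;q,2,2) + S(2,x/2+1;q,1,1) + S(1,x;q,2,−2) + S(1,x/2;q,1,−1)](w_q)`,
`w_q(e) = 𝟙[y < qe] μ(q) μ(e) log²(qe)`. -/
theorem twinUnbalancedSum_eq_switched {y z : ℕ} (h : z * z ≤ y) (x : ℕ) :
    twinUnbalancedSum x y z = ∑ q ∈ Icc 1 (x + 2), if q ≤ z then
        switchedSum 3 (x + 2) q 2 2 (twinSwitchWeight y q)
          + switchedSum 2 (x / 2 + 1) q 1 1 (twinSwitchWeight y q)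
          + switchedSum 1 x q 2 (-2) (twinSwitchWeight y q)
          + switchedSum 1 (x / 2) q 1 (-1) (twinSwitchWeight y q) else 0 := by
  rw [twinUnbalancedSum_eq_fst_add_snd h, twinUnbalancedFst_eq_switched,
    twinUnbalancedSnd_eq_switched, ← sum_add_distrib]
  refine sum_congr rfl fun q _ => ?_
  split_ifs <;> ring

end Summit.Parity.BatemanHorn.Theorems
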